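import Mathlib.Analysis.InnerProductSpace.Harmonic.Basic
import Literature.Analysis.FluidPDE.NormalisedPressure
import HarnessLib

/-!
# Tao's pressure-normalisation lemma (Lemma 4.1 (i)): decomposition along the printed proof

Sibling of `NormalisedPressure.lean` (fact `NS.tao_pressure_normalisation`, Tao 2011 = arXiv:1108.1165,
Lemma 4.1 (i) — "Lemma 25" in the arXiv text rendering, §4 pp. 14–15). The fact is an XL discharge:
Mathlib (this pin) has neither singular-integral (Riesz transform / Newtonian potential) theory nor
the mean value property of harmonic functions on `ℝⁿ` (only `InnerProductSpace.HarmonicAt`, the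
definition). Following the tree's decomposition protocol (cf. `NSUnconditionalUniquenessProofs`),
this file vendors the classical inputs of the printed proof as named facts (nothing asserted) and is
the home of the assembly `tao_pressure_normalisation_of_parts` (glue = Tao's own argument).

## The printed proof (Tao 2011, §4, proof of Lemma 4.1, finite energy case)

Write `p = p₀ + h` with `p₀ := -Δ⁻¹∂ᵢ∂ⱼ(uᵢuⱼ)` (`= normalisedPressure (u t)`) and `h(t)` harmonic
(from the pressure Poisson equation (8), `Δp = -∂ᵢ∂ⱼ(uᵢuⱼ)`); `p₀` is locally bounded because `u`
is smooth with finite energy. Test the momentum equation against `R⁻³χ(x/R)` (`χ` radial, mass one)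
on `[t₁, t₂]`: by finite energy and Cauchy–Schwarz every velocity term is `o(1)` as `R → ∞`, so
`∫∫ ∇p χ_R → 0`; by duality `∫∫ ∇p₀ χ_R = R⁻⁴ ∫∫ uᵢuⱼ (∇Δ⁻¹∂ᵢ∂ⱼχ)(x/R) → 0`; hence
`∫∫ ∇h χ_R → 0`, which by the mean value property equals `∫_{t₁}^{t₂} ∇h(t,0) dt` for every `R`.
Lebesgue differentiation in `t`, a countable dense set of centres and continuity of `∇h(t)` give
`∇h(t) ≡ 0` for a.e. `t`. (The viscosity only enters through `ν ∫∫ u Δχ_R = O(R^{-7/2})`, so the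
`ν = 1` normalisation of the paper is immaterial.)

## The named facts (inputs), all on `ℝ³ = EuclideanSpace ℝ (Fin 3)` except F0, F4 (general `E`)

* F0 `NS.tao2011_pressurePoisson` — Tao (8): `Δp = -∂ᵢ∂ⱼ(uᵢuⱼ) + ∇·f`, i.e.
  `Δ(p t) = -div((u·∇)u + (div u) u) + div f = -div((u·∇)u) + div f` at interior times of the
  time set, for the tree's classical solutions. [cite: Tao2011, (8)]
* F1 `NS.hasPressurePV_of_contDiff` — the principal value `p.v.∫ K(x-y)(v(y)) dy` exists at every
  point for `v ∈ C¹ ∩ L²` (the kernel `K(z)(a) = (3⟨z,a⟩² - |a|²|z|²)/(4π|z|⁵)` has zero spherical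
  means; Stein 1970, Ch. III §1 / Ch. II §4 (truncated singular integrals of `C¹` functions);
  Gilbarg–Trudinger (4.9)). [cite: Stein1970, Ch. III §1]
* F1b `NS.truncatedPressureIntegral_bound` — the uniform bound
  `|∫_{|x-y|>ε} K(x-y)(v y) dy| ≤ A (M₀M₁ + M₀² + ‖v‖₂²)`, `0 < ε ≤ 1`, `M₀ = sup_{B̄(x,1)}|v|`,
  `M₁ = sup_{B̄(x,1)}|Dv|` (near field by cancellation + mean value inequality, far field by
  `|K(z)| ≤ |z|⁻³/π`). [cite: Stein1970, Ch. II §4.1] (Tao: "p₀ is bounded on compact subsets").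
* F2 `NS.integral_normalisedPressure_mul_rescaled_le` — duality + dilation invariance: for a test
  function `ψ` there is `M_ψ` with `|∫ p̃[v](x) ψ((x-x₀)/R) dx| ≤ M_ψ ‖v‖₂²` for all `x₀`, `R > 0`
  (`∫ p̃[v] ψ_R = Σ ∫ vᵢvⱼ (T*ᵢⱼψ)((·-x₀)/R)`, `T*ᵢⱼψ = -Γ * ∂ᵢ∂ⱼψ` bounded). This is the sentence
  "From the finite energy nature of `(u,p,u₀,f,T)` we see that this expression goes to zero" of the
  printed proof, in scale-free form. [cite: Tao2011, §4, proof of Lemma 4.1 (i)]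
* F3 `NS.laplacian_normalisedPressure` — `p̃[v] ∈ C²` and `Δp̃[v] = -∂ᵢ∂ⱼ(vᵢvⱼ)` pointwise for
  smooth finite-energy `v` (Gilbarg–Trudinger Lemma 4.2 with (2.17): `w = Γ * g ∈ C²`, `Δw = g`,
  `∂ᵢⱼw` given by the p.v. formula (4.9)–(4.10); whole-space `L¹` density handled by a near/far
  split). [cite: GilbargTrudinger2001, Lemma 4.2]
* F4 `NS.harmonic_integral_mul_radial` — mean value property in weighted radial form on a
  finite-dimensional inner product space: `∫ w(x) η(x₀ + x) dx = (∫ w) η(x₀)` for `η` harmonic and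
  `w` a smooth compactly supported radial weight (Gilbarg–Trudinger Thm 2.1 integrated against the
  radial profile). [cite: GilbargTrudinger2001, Thm 2.1]

`∂ᵢ∂ⱼ(vᵢvⱼ)` is written basis-free as `div((v·∇)v + (div v) v)` (`∂ⱼ(vᵢvⱼ) = vⱼ∂ⱼvᵢ + vᵢ∂ⱼvⱼ`).

## Mathlib search

`InnerProductSpace.HarmonicAt/HarmonicOnNhd` (used, F4), `Laplacian` (`Δ`), no `meanValue` for
`ℝⁿ` (only complex `circleAverage`), no `rieszTransform`/`newtonianPotential`/`singularIntegral`,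
`ContDiffBump` (not provably radial: `someContDiffBumpBase` is chosen by `Nonempty.some`, hence F4
quantifies over radial weights explicitly), `Fluid.divergence`/`Fluid.convect` (tree, VectorCalculus).

## References

* T. Tao, *Localisation and compactness properties of the Navier–Stokes global regularity
  problem*, Anal. PDE 6 (2013) 25–107 = arXiv:1108.1165: (8) p. 4; §4, Lemma 4.1 and its proof,
  pp. 24–26 (journal) = pp. 14–15 (arXiv text).
* D. Gilbarg, N. S. Trudinger, *Elliptic partial differential equations of second order*
  (Springer, 2001 reprint): Thm 2.1 (mean value), (2.12), (2.17), Lemma 4.1, Lemma 4.2, (4.9)–(4.10).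
* E. M. Stein, *Singular integrals and differentiability properties of functions* (1970),
  Ch. II §4, Ch. III §1.
-/

noncomputable section

open MeasureTheory Set Filter Metric Topology InnerProductSpace
open scoped ENNReal RealInnerProductSpace ContDiff Laplacian

namespace Literature.Analysis.FluidPDE

/-- Local notation for physical space `ℝ³ = EuclideanSpace ℝ (Fin 3)`. -/
local notation "ℝ³" => EuclideanSpace ℝ (Fin 3)

section General

variable {E : Type*} [NormedAddCommGroup E] [InnerProductSpace ℝ E] [FiniteDimensional ℝ E]

/-- **Tao 2011, (8) (pressure Poisson equation).** "If one takes the divergence of (ns) and use the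
incompressibility (div-free), one sees that `Δp = -∂ᵢ∂ⱼ(uᵢuⱼ) + ∇·f`." Rendered for the tree's
classical solutions `Fluid.IsClassicalNSSolutionOn S ν f u p` (jointly smooth on `S × E`) at the
interior times of `S` (where the one-sided time derivative is the two-sided one and mixed partials
commute), basis-free: `∂ᵢ∂ⱼ(uᵢuⱼ) = div((u·∇)u + (div u) u)` and `div u = 0`, so
`Δ(p t) x = -div((u t·∇)(u t)) x + div(f t) x`. Any viscosity `ν` (the term `ν div Δu = ν Δ div u`
vanishes). Nothing asserted. [cite: Tao2011, (8)] -/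
def tao2011_pressurePoisson : Prop :=
  ∀ (S : Set ℝ) (ν : ℝ) (f u : ℝ → E → E) (p : ℝ → E → ℝ),
    FluidPDE.IsClassicalNSSolutionOn S ν f u p → ∀ t ∈ interior S, ∀ x,
      Δ (p t) x = -VectorCalculus.divergence (FluidPDE.convect (u t) (u t)) x + VectorCalculus.divergence (f t) x

variable [MeasurableSpace E] [BorelSpace E]

/-- **Mean value property, weighted radial form (Gilbarg–Trudinger, Thm 2.1).** GT Thm 2.1: for
`u ∈ C²(Ω)` with `Δu = 0` and any ball `B = B_R(y) ⊂⊂ Ω`,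
`u(y) = (n ωₙ Rⁿ⁻¹)⁻¹ ∫_{∂B} u ds = (ωₙ Rⁿ)⁻¹ ∫_B u dx`. Integrating the sphere form against a radial
profile gives the form vendored here, on a finite-dimensional real inner product space `E` with its
Lebesgue measure: if `η` is harmonic on all of `E` (Mathlib `InnerProductSpace.HarmonicOnNhd η univ`:
`C²` near every point with `Δη = 0`) and `w : E → ℝ` is a smooth compactly supported **radial** weight
(`w x` depends only on `‖x‖`), then `∫ w(x) η(x₀ + x) dx = (∫ w) · η(x₀)` for every centre `x₀`.
Nothing asserted. [cite: GilbargTrudinger2001, Thm 2.1] -/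
def harmonic_integral_mul_radial : Prop :=
  ∀ (η w : E → ℝ), HarmonicOnNhd η univ → ContDiff ℝ ∞ w → HasCompactSupport w →
    (∀ x y, ‖x‖ = ‖y‖ → w x = w y) →
    ∀ x₀ : E, ∫ x, w x * η (x₀ + x) = (∫ x, w x) * η x₀

end General

/-! ### Singular-integral inputs on `ℝ³` -/

/-- **Existence of the principal value (Stein 1970, Ch. III §1; Gilbarg–Trudinger (4.9)).** For a
`C¹` velocity slice `v : ℝ³ → ℝ³` of finite energy `∫ |v|² < ∞`, the principal value
`p.v.∫ K(x - y)(v(y)) dy` defining the normalised pressure exists at **every** point `x`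
(`HasPressurePV v x L` for some `L`): the far field `|x - y| > 1` converges absolutely
(`|K(z)(a)| ≤ |a|²/(π|z|³)`, `v ∈ L²`), and on `ε < |x - y| ≤ 1` the kernel has zero mean on spheres
(`∫_{|z|=r} (3⟨z,a⟩² - |a|²|z|²) dσ = 0`), so `v(y)` may be replaced by `v(y) - v(x)`-increments,
which gain a factor `|x - y|` by the mean value inequality. Nothing asserted.
[cite: Stein1970, Ch. III §1] -/
def hasPressurePV_of_contDiff : Prop :=
  ∀ v : ℝ³ → ℝ³, ContDiff ℝ 1 v → (∫⁻ x, ‖v x‖ₑ ^ 2) < ⊤ → ∀ x, ∃ L, HasPressurePV v x L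

/-- **Uniform bound for the truncated singular integrals (Stein 1970, Ch. II §4; the estimate behind
Tao's "p₀ is bounded on compact subsets of spacetime").** There is an absolute constant `A` such that
for every `C¹` finite-energy `v : ℝ³ → ℝ³`, every `x`, every `M₀ ≥ sup_{|y-x|≤1} |v(y)|`,
`M₁ ≥ sup_{|y-x|≤1} ‖Dv(y)‖` and every `0 < ε ≤ 1`,
`|∫_{|x-y|>ε} K(x-y)(v(y)) dy| ≤ A (M₀ M₁ + M₀² + ∫|v|²)`
(near field `≤ 8 M₀M₁` by cancellation, far field `≤ ‖v‖₂²/π`). Consequently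
`|p̃[v](x)| ≤ M₀²/3 + A(M₀M₁ + M₀² + ‖v‖₂²)`. Nothing asserted. [cite: Stein1970, Ch. II §4] -/
def truncatedPressureIntegral_bound : Prop :=
  ∃ A : ℝ, ∀ v : ℝ³ → ℝ³, ContDiff ℝ 1 v → (∫⁻ x, ‖v x‖ₑ ^ 2) < ⊤ →
    ∀ (x : ℝ³) (M₀ M₁ : ℝ), (∀ y ∈ closedBall x 1, ‖v y‖ ≤ M₀) →
      (∀ y ∈ closedBall x 1, ‖fderiv ℝ v y‖ ≤ M₁) →
      ∀ ε ∈ Ioc (0 : ℝ) 1,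
        |truncatedPressureIntegral v x ε| ≤ A * (M₀ * M₁ + M₀ ^ 2 + (∫⁻ y, ‖v y‖ₑ ^ 2).toReal)

/-- **Duality and dilation bound (Tao 2011, §4, proof of Lemma 4.1 (i): "by an integration by parts
and (p0-def) … `R⁻⁴ ∫∫ uᵢuⱼ (∇Δ⁻¹∂ᵢ∂ⱼχ)(x/R)` … from the finite energy nature … this expression
goes to zero as `R → ∞`").** Scale-free form: for every test function `ψ ∈ C_c^∞(ℝ³)` there is a
constant `M` such that for every `C¹` finite-energy `v`, every centre `x₀` and every scale `R > 0`,
`|∫ p̃[v](x) ψ((x - x₀)/R) dx| ≤ M ∫|v|²`.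
(Reason: `∫ p̃[v] ψ_R = Σᵢⱼ ∫ vᵢvⱼ · T*ᵢⱼ[ψ_R]` with `T*ᵢⱼψ = -Γ * ∂ᵢ∂ⱼψ` bounded, and
`T*ᵢⱼ[ψ((·-x₀)/R)] = (T*ᵢⱼψ)((·-x₀)/R)` since the operator is translation invariant and homogeneous
of degree `0`; Stein 1970, Ch. III §1.) With `ψ = ∂ₖχ` and the extra `R⁻¹` from the chain rule this
is Tao's `R⁻⁴` decay. The integral is a Bochner integral (the integrand is integrable: `p̃[v]` is
locally bounded by `truncatedPressureIntegral_bound` and measurable). Nothing asserted.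
[cite: Tao2011, §4, proof of Lemma 4.1 (i)] -/
def integral_normalisedPressure_mul_rescaled_le : Prop :=
  ∀ ψ : ℝ³ → ℝ, ContDiff ℝ ∞ ψ → HasCompactSupport ψ →
    ∃ M : ℝ, ∀ v : ℝ³ → ℝ³, ContDiff ℝ 1 v → (∫⁻ x, ‖v x‖ₑ ^ 2) < ⊤ →
      ∀ (x₀ : ℝ³) (R : ℝ), 0 < R →
        |∫ x, normalisedPressure v x * ψ (R⁻¹ • (x - x₀))| ≤ M * (∫⁻ x, ‖v x‖ₑ ^ 2).toReal

/-- **The normalised pressure solves the pressure Poisson equation classically (Gilbarg–Trudinger,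
Lemma 4.2 with (2.17), (4.9)–(4.10)).** GT Lemma 4.2: for `f` bounded and locally Hölder (a fortiori
`C¹`) the Newtonian potential `w = Γ * f` is `C²`, `Δw = f`, and
`∂ᵢⱼw(x) = ∫_{Ω₀} ∂ᵢⱼΓ(x-y)(f(y) - f(x)) dy - f(x)∫_{∂Ω₀} ∂ᵢΓ νⱼ` (`= p.v.∫ ∂ᵢⱼΓ f + δᵢⱼ f(x)/n` for
`Ω₀` a ball). Applied on `ℝ³` to the entries of `v ⊗ v` for a smooth finite-energy field `v` (the
`L¹` tail `|x-y| > 1` is a smooth harmonic far field), and contracted: the normalised pressure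
`p̃[v] = -|v|²/3 + p.v.∫ K(·-y)(v y) dy = -Σᵢⱼ ∂ᵢ∂ⱼ(Γ * vᵢvⱼ)` is `C²` and
`Δ p̃[v] = -∂ᵢ∂ⱼ(vᵢvⱼ) = -div((v·∇)v + (div v) v)` pointwise. Nothing asserted.
[cite: GilbargTrudinger2001, Lemma 4.2] -/
def laplacian_normalisedPressure : Prop :=
  ∀ v : ℝ³ → ℝ³, ContDiff ℝ ∞ v → (∫⁻ x, ‖v x‖ₑ ^ 2) < ⊤ →
    ContDiff ℝ 2 (normalisedPressure v) ∧
      ∀ x, Δ (normalisedPressure v) x =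
        -VectorCalculus.divergence (fun y ↦ FluidPDE.convect v v y + VectorCalculus.divergence v y • v y) x

/-! ### First consequences (proved) -/

/-- On the admissible class the junk branch of `normalisedPressure` is never taken: for `C¹`
finite-energy `v`, `p̃[v](x) = -|v(x)|²/3 + p.v.∫ K(x-y)(v y) dy` with the principal value of F1.
[cite: Stein1970, Ch. III §1] -/
theorem hasPressurePV_of_contDiff.normalisedPressure_eq (h : hasPressurePV_of_contDiff)
    {v : ℝ³ → ℝ³} (hv : ContDiff ℝ 1 v) (hE : (∫⁻ x, ‖v x‖ₑ ^ 2) < ⊤) (x : ℝ³) :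
    ∃ L, HasPressurePV v x L ∧
      normalisedPressure v x = -‖v x‖ ^ 2 / 3 + L := by
  obtain ⟨L, hL⟩ := h v hv hE x
  refine ⟨L, hL, ?_⟩
  rw [Literature.Analysis.FluidPDE.normalisedPressure_eq hL, finrank_euclideanSpace_fin]
  norm_num

/-- For a divergence-free field the correction term in F3 vanishes:
`Δ p̃[v] = -div((v·∇)v)` (the form matching Tao's (8) with `div u = 0`). [cite: GilbargTrudinger2001, Lemma 4.2] -/
theorem laplacian_normalisedPressure.of_isDivFree (h : laplacian_normalisedPressure)
    {v : ℝ³ → ℝ³} (hv : ContDiff ℝ ∞ v) (hE : (∫⁻ x, ‖v x‖ₑ ^ 2) < ⊤) (hdiv : VectorCalculus.IsDivFree v)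
    (x : ℝ³) :
    Δ (normalisedPressure v) x = -VectorCalculus.divergence (FluidPDE.convect v v) x := by
  rw [(h v hv hE).2 x]
  have : (fun y ↦ FluidPDE.convect v v y + VectorCalculus.divergence v y • v y) = FluidPDE.convect v v := by
    funext y
    rw [hdiv y, zero_smul, add_zero]
  rw [this]

end Literature.Analysis.FluidPDE

end
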